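import Summits.Ventures.PercRepro.S1TriangleVCount
import Summits.Ventures.PercRepro.S1FourCircuitW2
import Summits.Ventures.PercRepro.S1FiveCircuitX
import Summits.Ventures.PercRepro.S1CellCaps5

/-!
# PercRepro — the cells `(7, 38)`, `(7, 39)`, `(7, 40)` of the `q = 4` window, by LEMMAS V, W′ and X (p2, gen 18)

The far end of the row `p = 7`: at `n = 45, 46, 47` LEMMA V gives `s₃ ≤ 225 / 235 / 245`, LEMMA W′ the curve
`s₄ ≤ ⌊(n(n−1)(n−2) − 2n·s₃)/8⌋` for the ACTUAL `s₃`, and LEMMA X `s₅ ≤ 178794 / 195822 / 214038` (the chain's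
`C(d + 4, 5)` is `850668 / 962598 / 1086008`). The three-cap cell inequality `cellOK14 7 d s₃ S(s₃) X` holds along
each curve (kernel tables of `226 / 236 / 246` cells; the twin's worst ratios `0.9757 / 0.9259 / 0.8718`), so the
`e`-free cores of rank `7` with `45`, `46`, `47` points satisfy `RLS` at level `4`: the row `p = 7` now ends at
`(7, 37)`.

* `cell_seven_thirtyeight_table`, `cell_seven_thirtynine_table`, `cell_seven_forty_table` — the kernel tables;
* **`c025_core_seven_thirtyeight`**, **`c025_core_seven_thirtynine`**, **`c025_core_seven_forty`** — the cores.
Axioms: standard.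
-/

open scoped Matroid

namespace PercRepro

namespace S1

open Set

variable {α : Type}

/-- The cells `(7, 38)` along LEMMA W′'s curve with LEMMA X's `s₅ ≤ 178794`: for every `s₃ ≤ 225`. -/
theorem cell_seven_thirtyeight_table :
    ∀ P < 226, cellOK14 7 38 P ((85140 - 90 * P) / 8) 178794 = true := by
  decide +kernel

/-- The cells `(7, 39)` along LEMMA W′'s curve with LEMMA X's `s₅ ≤ 195822`: for every `s₃ ≤ 235`. -/
theorem cell_seven_thirtynine_table :
    ∀ P < 236, cellOK14 7 39 P ((91080 - 92 * P) / 8) 195822 = true := by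
  decide +kernel

/-- The cells `(7, 40)` along LEMMA W′'s curve with LEMMA X's `s₅ ≤ 214038`: for every `s₃ ≤ 245`. -/
theorem cell_seven_forty_table :
    ∀ P < 246, cellOK14 7 40 P ((97290 - 94 * P) / 8) 214038 = true := by
  decide +kernel

/-- **THE CELL `(7, 38)`**: an `e`-free core of rank `7` with `45` points satisfies `RLS` at level `4`. -/
theorem c025_core_seven_thirtyeight (M : Matroid α) [M.Finite] (hR : M.eRank = (7 : ℕ)) (hn : M.E.ncard = 45)
    (hfree : ∀ e ∈ M.E, ∃ A ⊆ M.E \ {e}, e ∉ M.closure A ∧ e ∉ M.closure ((M.E \ {e}) \ A)) :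
    ThmN.RLS M 7 4 := by
  have hP : {C : Set α | M.IsCircuit C ∧ C.ncard = 3}.ncard ≤ 225 := by
    have h := core_ncard_triangles_le_sq_div_nine M hfree
    rw [hn] at h
    exact h.trans (by norm_num)
  have hW := core_eight_mul_ncard_fourCircuits_add_le M hfree
  rw [hn] at hW
  have hS : {C : Set α | M.IsCircuit C ∧ C.ncard = 4}.ncard ≤
      (85140 - 90 * {C : Set α | M.IsCircuit C ∧ C.ncard = 3}.ncard) / 8 := by
    rw [Nat.le_div_iff_mul_le (by norm_num)]
    omega
  have hS5 : {C : Set α | M.IsCircuit C ∧ C.ncard = 5}.ncard ≤ 178794 := by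
    have h := core_ncard_fiveCircuits_le_mul_div M hfree
    rw [hn] at h
    exact h.trans (by norm_num)
  exact rls_of_cellOK14 M 7 38 _ _ 178794 (by norm_num) hR hn hfree le_rfl hS hS5 (by norm_num)
    (cell_seven_thirtyeight_table _ (by omega))

/-- **THE CELL `(7, 39)`**: an `e`-free core of rank `7` with `46` points satisfies `RLS` at level `4`. -/
theorem c025_core_seven_thirtynine (M : Matroid α) [M.Finite] (hR : M.eRank = (7 : ℕ)) (hn : M.E.ncard = 46)
    (hfree : ∀ e ∈ M.E, ∃ A ⊆ M.E \ {e}, e ∉ M.closure A ∧ e ∉ M.closure ((M.E \ {e}) \ A)) :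
    ThmN.RLS M 7 4 := by
  have hP : {C : Set α | M.IsCircuit C ∧ C.ncard = 3}.ncard ≤ 235 := by
    have h := core_ncard_triangles_le_sq_div_nine M hfree
    rw [hn] at h
    exact h.trans (by norm_num)
  have hW := core_eight_mul_ncard_fourCircuits_add_le M hfree
  rw [hn] at hW
  have hS : {C : Set α | M.IsCircuit C ∧ C.ncard = 4}.ncard ≤
      (91080 - 92 * {C : Set α | M.IsCircuit C ∧ C.ncard = 3}.ncard) / 8 := by
    rw [Nat.le_div_iff_mul_le (by norm_num)]
    omega
  have hS5 : {C : Set α | M.IsCircuit C ∧ C.ncard = 5}.ncard ≤ 195822 := by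
    have h := core_ncard_fiveCircuits_le_mul_div M hfree
    rw [hn] at h
    exact h.trans (by norm_num)
  exact rls_of_cellOK14 M 7 39 _ _ 195822 (by norm_num) hR hn hfree le_rfl hS hS5 (by norm_num)
    (cell_seven_thirtynine_table _ (by omega))

/-- **THE CELL `(7, 40)`**: an `e`-free core of rank `7` with `47` points satisfies `RLS` at level `4`. -/
theorem c025_core_seven_forty (M : Matroid α) [M.Finite] (hR : M.eRank = (7 : ℕ)) (hn : M.E.ncard = 47)
    (hfree : ∀ e ∈ M.E, ∃ A ⊆ M.E \ {e}, e ∉ M.closure A ∧ e ∉ M.closure ((M.E \ {e}) \ A)) :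
    ThmN.RLS M 7 4 := by
  have hP : {C : Set α | M.IsCircuit C ∧ C.ncard = 3}.ncard ≤ 245 := by
    have h := core_ncard_triangles_le_sq_div_nine M hfree
    rw [hn] at h
    exact h.trans (by norm_num)
  have hW := core_eight_mul_ncard_fourCircuits_add_le M hfree
  rw [hn] at hW
  have hS : {C : Set α | M.IsCircuit C ∧ C.ncard = 4}.ncard ≤
      (97290 - 94 * {C : Set α | M.IsCircuit C ∧ C.ncard = 3}.ncard) / 8 := by
    rw [Nat.le_div_iff_mul_le (by norm_num)]
    omega
  have hS5 : {C : Set α | M.IsCircuit C ∧ C.ncard = 5}.ncard ≤ 214038 := by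
    have h := core_ncard_fiveCircuits_le_mul_div M hfree
    rw [hn] at h
    exact h.trans (by norm_num)
  exact rls_of_cellOK14 M 7 40 _ _ 214038 (by norm_num) hR hn hfree le_rfl hS hS5 (by norm_num)
    (cell_seven_forty_table _ (by omega))

end S1

end PercRepro
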